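import Mathlib
import HarnessLib
import Literature.Analysis.FluidPDE.TypeIAncientMild
import Literature.Analysis.FluidPDE.OseenSlice
import Literature.Analysis.FluidPDE.UlocKernelEstimates
import Literature.Analysis.FluidPDE.LerayVolterraComparison
import Literature.Analysis.FluidPDE.OseenDuhamelPairCalculus
import Summits.NavierStokesRegularity.NavierStokesRegularity.Theorems.QuarterLogPincerTruncationEdgeDefs
import Summits.NavierStokesRegularity.NavierStokesRegularity.Theorems.QuarterLogPincerTypeIQuantSubcubicExpFrameTools
import Summits.NavierStokesRegularity.NavierStokesRegularity.Theorems.QuarterLogPincerQuietCoreDefs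

/-!
# Route `QuarterLogPincer`, crux `TypeIQuantSubcubicExp` (stmt-NavierStokesRegularity-24077), line `quiet_core` —
# §1d part 1 (PROVED in-file v1.4; ported VERBATIM): the LOG-CORRECTED recession law and the kernel-crossover integral

`recessPhi`, `recessRate`, `hasDerivAt_recessPhi`, `recessRate_pos`, `recessRate_antitone`, `recessRate_mul_sub_le`, `recessPhi_lt`, `recessPhi_self`;
`intervalIntegral_sub_rpow_neg_half`, `intervalIntegral_inv_sub`, `crossover_integral_le`, `intervalIntegrable_crossMin`.
HONEST FRAME: estimates about HYPOTHETICAL Type-I ancient mild fields; nothing here bears on 24077, W7 or Navier–Stokes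
regularity (OPEN).  Port by the pub-ns-dss typer (g36), DIRECTOR-NS KEY-NS #181/#182; bodies VERBATIM from tree `Lines/quiet_core.lean`
v1.5 (sha12 d1a96bf31391, ns-idea-7 g10; critic of record idea-crit-4 g6); docstrings added where the line had none.
-/

noncomputable section

set_option linter.dupNamespace false

namespace Summit.NavierStokesRegularity.NavierStokesRegularity.Cruxes.TypeIQuantSubcubicExp.QuietCore

open MeasureTheory Set Function Metric Filter Topology
open scoped ENNReal NNReal
open Literature.Analysis Literature.Analysis.FluidPDE
open Summit.NavierStokesRegularity.NavierStokesRegularity.Cruxes.TypeIQuantSubcubicExp.TruncationEdge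

section RecessionLaw
open Real

/-! ### §1d  S3♭ toolbox (PROVED, v1.4): T1 — the LOG-CORRECTED recession law and the far-kick calculus
(the fourth of the four planned lemmas; with §1c this leaves only the real-induction ASSEMBLY T4 of S3♭ open).
`Φ(u) = 8κ b^{3/8} u^{1/8}(c₁ + 8 + log(b/u))`, `Φ' = φ(u) = κ b^{3/8} u^{-7/8}(c₁ + log(b/u))`,
`φ` positive and antitone on `(0,b]`, hence `Φ(v) − Φ(a) ≥ φ(v)(v − a)` for `0 < a < v ≤ b`. -/

/-- The recession profile `Φ`. -/
noncomputable def recessPhi (κ b c₁ u : ℝ) : ℝ :=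
  8 * κ * b ^ (3 / 8 : ℝ) * u ^ (1 / 8 : ℝ) * (c₁ + 8 + Real.log (b / u))

/-- The recession rate `φ = Φ'`. -/
noncomputable def recessRate (κ b c₁ u : ℝ) : ℝ :=
  κ * b ^ (3 / 8 : ℝ) * u ^ (-(7 / 8 : ℝ)) * (c₁ + Real.log (b / u))

/-- `hasDerivAt_recessPhi` (line `quiet_core` §1d, ns-idea-7 g10; ported verbatim). [this file] -/
theorem hasDerivAt_recessPhi {κ b c₁ u : ℝ} (hb : 0 < b) (hu : 0 < u) :
    HasDerivAt (recessPhi κ b c₁) (recessRate κ b c₁ u) u := by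
  have h1 : HasDerivAt (fun x : ℝ => x ^ (1 / 8 : ℝ)) ((1 / 8 : ℝ) * u ^ ((1 / 8 : ℝ) - 1)) u :=
    Real.hasDerivAt_rpow_const (Or.inl hu.ne')
  have h2 : HasDerivAt (fun x : ℝ => c₁ + 8 + Real.log (b / x)) (-(u⁻¹)) u := by
    have hl : HasDerivAt (fun x : ℝ => Real.log (b / x)) (-(u⁻¹)) u := by
      have hlog : ∀ᶠ x in nhds u, Real.log (b / x) = Real.log b - Real.log x := by
        filter_upwards [lt_mem_nhds hu] with x hx
        rw [Real.log_div hb.ne' hx.ne']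
      refine HasDerivAt.congr_of_eventuallyEq ?_ hlog
      simpa using (Real.hasDerivAt_log hu.ne').const_sub (Real.log b)
    simpa using hl.const_add (c₁ + 8)
  have h12 := h1.mul h2
  have h3 : HasDerivAt (fun x : ℝ => 8 * κ * b ^ (3 / 8 : ℝ) * (x ^ (1 / 8 : ℝ) * (c₁ + 8 + Real.log (b / x))))
      (8 * κ * b ^ (3 / 8 : ℝ) * ((1 / 8 : ℝ) * u ^ ((1 / 8 : ℝ) - 1) * (c₁ + 8 + Real.log (b / u)) +
        u ^ (1 / 8 : ℝ) * -(u⁻¹))) u := h12.const_mul _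
  have hfun : recessPhi κ b c₁ =
      fun x : ℝ => 8 * κ * b ^ (3 / 8 : ℝ) * (x ^ (1 / 8 : ℝ) * (c₁ + 8 + Real.log (b / x))) := by
    funext x; simp only [recessPhi]; ring
  rw [hfun]
  convert h3 using 1
  -- value of the derivative
  have hpow : u ^ ((1 / 8 : ℝ) - 1) = u ^ (-(7 / 8 : ℝ)) := by norm_num
  have hpow2 : u ^ (1 / 8 : ℝ) * u⁻¹ = u ^ (-(7 / 8 : ℝ)) := by
    rw [← Real.rpow_neg_one, ← Real.rpow_add hu]; norm_num
  simp only [recessRate]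
  rw [hpow]
  have : u ^ (1 / 8 : ℝ) * -u⁻¹ = -(u ^ (-(7 / 8 : ℝ))) := by rw [mul_neg, hpow2]
  calc κ * b ^ (3 / 8 : ℝ) * u ^ (-(7 / 8 : ℝ)) * (c₁ + Real.log (b / u))
      = 8 * κ * b ^ (3 / 8 : ℝ) * ((1 / 8 : ℝ) * u ^ (-(7 / 8 : ℝ)) * (c₁ + 8 + Real.log (b / u)) +
          -(u ^ (-(7 / 8 : ℝ)))) := by ring
    _ = 8 * κ * b ^ (3 / 8 : ℝ) * ((1 / 8 : ℝ) * u ^ (-(7 / 8 : ℝ)) * (c₁ + 8 + Real.log (b / u)) +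
          u ^ (1 / 8 : ℝ) * -u⁻¹) := by rw [this]

/-- `continuousOn_recessPhi` (line `quiet_core` §1d, ns-idea-7 g10; ported verbatim). [this file] -/
theorem continuousOn_recessPhi {κ b c₁ : ℝ} (hb : 0 < b) : ContinuousOn (recessPhi κ b c₁) (Ioi 0) :=
  fun _ hu => (hasDerivAt_recessPhi (κ := κ) (c₁ := c₁) hb hu).continuousAt.continuousWithinAt

/-- `φ > 0` on `(0, b]` when `κ > 0`, `c₁ > 0`. -/
theorem recessRate_pos {κ b c₁ u : ℝ} (hκ : 0 < κ) (hb : 0 < b) (hc₁ : 0 < c₁) (hu : 0 < u) (hub : u ≤ b) :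
    0 < recessRate κ b c₁ u := by
  have hlog : 0 ≤ Real.log (b / u) := Real.log_nonneg (by rw [le_div_iff₀ hu, one_mul]; exact hub)
  unfold recessRate
  have h1 : 0 < b ^ (3 / 8 : ℝ) := Real.rpow_pos_of_pos hb _
  have h2 : 0 < u ^ (-(7 / 8 : ℝ)) := Real.rpow_pos_of_pos hu _
  have h3 : 0 < c₁ + Real.log (b / u) := by linarith
  positivity

/-- `φ` is antitone on `(0, b]`. -/
theorem recessRate_antitone {κ b c₁ u v : ℝ} (hκ : 0 < κ) (hb : 0 < b) (hc₁ : 0 < c₁)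
    (hu : 0 < u) (huv : u ≤ v) (hvb : v ≤ b) :
    recessRate κ b c₁ v ≤ recessRate κ b c₁ u := by
  have hv : 0 < v := hu.trans_le huv
  unfold recessRate
  have h1 : 0 < b ^ (3 / 8 : ℝ) := Real.rpow_pos_of_pos hb _
  have hpow : v ^ (-(7 / 8 : ℝ)) ≤ u ^ (-(7 / 8 : ℝ)) :=
    Real.rpow_le_rpow_of_nonpos hu huv (by norm_num)
  have hlogv : 0 ≤ Real.log (b / v) := Real.log_nonneg (by rw [le_div_iff₀ hv, one_mul]; exact hvb)
  have hlog : Real.log (b / v) ≤ Real.log (b / u) :=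
    Real.log_le_log (div_pos hb hv) (div_le_div_of_nonneg_left hb.le hu huv)
  have hA : 0 ≤ κ * b ^ (3 / 8 : ℝ) := by positivity
  have hB : 0 ≤ u ^ (-(7 / 8 : ℝ)) := Real.rpow_nonneg hu.le _
  calc κ * b ^ (3 / 8 : ℝ) * v ^ (-(7 / 8 : ℝ)) * (c₁ + Real.log (b / v))
      ≤ κ * b ^ (3 / 8 : ℝ) * u ^ (-(7 / 8 : ℝ)) * (c₁ + Real.log (b / u)) := by
        apply mul_le_mul (mul_le_mul_of_nonneg_left hpow hA) (by linarith) (by linarith) (mul_nonneg hA hB)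

/-- **Mean-value lower bound for the recession distance**: for `0 < a < v ≤ b`,
`Φ(v) − Φ(a) ≥ φ(v)·(v − a)` (the distance between the receding spheres at times `−v < −a` is at least the
current rate times the elapsed time). -/
theorem recessRate_mul_sub_le {κ b c₁ a v : ℝ} (hκ : 0 < κ) (hb : 0 < b) (hc₁ : 0 < c₁)
    (ha : 0 < a) (hav : a < v) (hvb : v ≤ b) :
    recessRate κ b c₁ v * (v - a) ≤ recessPhi κ b c₁ v - recessPhi κ b c₁ a := by
  have hcont : ContinuousOn (recessPhi κ b c₁) (Icc a v) :=
    (continuousOn_recessPhi hb).mono fun u hu => ha.trans_le hu.1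
  have hderiv : ∀ u ∈ Ioo a v, HasDerivAt (recessPhi κ b c₁) (recessRate κ b c₁ u) u :=
    fun u hu => hasDerivAt_recessPhi hb (ha.trans hu.1)
  obtain ⟨c, hc, hslope⟩ := exists_hasDerivAt_eq_slope (recessPhi κ b c₁) (recessRate κ b c₁) hav hcont hderiv
  have hva : 0 < v - a := sub_pos.2 hav
  have hrate : recessRate κ b c₁ v ≤ recessRate κ b c₁ c :=
    recessRate_antitone hκ hb hc₁ (ha.trans hc.1) hc.2.le hvb
  calc recessRate κ b c₁ v * (v - a) ≤ recessRate κ b c₁ c * (v - a) :=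
        mul_le_mul_of_nonneg_right hrate hva.le
    _ = recessPhi κ b c₁ v - recessPhi κ b c₁ a := by
        rw [hslope, div_mul_cancel₀ _ hva.ne']

/-- `Φ` is strictly increasing on `(0, b]` (so the spheres genuinely recede): `Φ(a) < Φ(v)` for `0 < a < v ≤ b`. -/
theorem recessPhi_lt {κ b c₁ a v : ℝ} (hκ : 0 < κ) (hb : 0 < b) (hc₁ : 0 < c₁)
    (ha : 0 < a) (hav : a < v) (hvb : v ≤ b) :
    recessPhi κ b c₁ a < recessPhi κ b c₁ v := by
  have h := recessRate_mul_sub_le hκ hb hc₁ ha hav hvb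
  have hpos : 0 < recessRate κ b c₁ v * (v - a) :=
    mul_pos (recessRate_pos hκ hb hc₁ (ha.trans hav) hvb) (sub_pos.2 hav)
  linarith

/-- Total recession: `Φ(b) = 8κ(c₁ + 8)√b` (`log(b/b) = 0`, `b^{3/8} b^{1/8} = b^{1/2}`). -/
theorem recessPhi_self {κ b c₁ : ℝ} (hb : 0 < b) :
    recessPhi κ b c₁ b = 8 * κ * (c₁ + 8) * Real.sqrt b := by
  unfold recessPhi
  rw [div_self hb.ne', Real.log_one, add_zero, Real.sqrt_eq_rpow,
    show (1 / 2 : ℝ) = 3 / 8 + 1 / 8 by norm_num, Real.rpow_add hb]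
  ring


/-! #### T1, near range: the kernel-crossover integral
`∫_a^{a+ℓ} min(I(u−a)^{-1/2}, 4π/(φ(u−a))) du ≤ (4π/φ)(2 + log⁺(a I² φ²/(16π²)))` for `0 < ℓ ≤ a`. -/

/-- `∫_a^{a+λ} (u−a)^{-1/2} du = 2 λ^{1/2}` (for `λ < 0` both sides use junk values consistently). -/
theorem intervalIntegral_sub_rpow_neg_half (a lam : ℝ) :
    ∫ u in a..(a + lam), (u - a) ^ (-(1 / 2 : ℝ)) = 2 * lam ^ (1 / 2 : ℝ) := by
  rw [intervalIntegral.integral_comp_sub_right (fun x : ℝ => x ^ (-(1 / 2 : ℝ))) a, sub_self,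
    add_sub_cancel_left, integral_rpow (Or.inl (by norm_num))]
  have h1 : (-(1 / 2 : ℝ)) + 1 = 1 / 2 := by norm_num
  rw [h1, Real.zero_rpow (by norm_num), sub_zero]
  ring

/-- `∫_{a+λ}^{a+ℓ} (u−a)^{-1} du = log(ℓ/λ)` for `0 < λ ≤ ℓ`. -/
theorem intervalIntegral_inv_sub {a lam ℓ : ℝ} (hlam : 0 < lam) (hℓ : lam ≤ ℓ) :
    ∫ u in (a + lam)..(a + ℓ), (u - a)⁻¹ = Real.log (ℓ / lam) := by
  rw [intervalIntegral.integral_comp_sub_right (fun x : ℝ => x⁻¹) a, add_sub_cancel_left, add_sub_cancel_left,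
    integral_inv_of_pos hlam (hlam.trans_le hℓ)]

/-- **Crossover integral.**  For `I, φ, a, ℓ > 0`, `ℓ ≤ a`:
`∫_a^{a+ℓ} min(I(u−a)^{-1/2}, 4π/(φ(u−a))) du ≤ (4π/φ)·(2 + log⁺(a·I²φ²/(16π²)))`
(below the crossover `λ₀ = (4π/(Iφ))²` use the square-root singularity, above it the `1/σ` tail). -/
theorem crossover_integral_le {I φ a ℓ : ℝ} (hI : 0 < I) (hφ : 0 < φ) (ha : 0 < a) (hℓ : 0 < ℓ) (hℓa : ℓ ≤ a) :
    ∫ u in a..(a + ℓ), min (I * (u - a) ^ (-(1 / 2 : ℝ))) (4 * π / (φ * (u - a))) ≤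
      (4 * π / φ) * (2 + max 0 (Real.log (a * (I ^ 2 * φ ^ 2 / (16 * π ^ 2))))) := by
  set lam0 : ℝ := (4 * π / (I * φ)) ^ 2 with hlam0
  have hlam0pos : 0 < lam0 := by rw [hlam0]; positivity
  set lam : ℝ := min lam0 ℓ with hlam
  have hlampos : 0 < lam := lt_min hlam0pos hℓ
  have hlamℓ : lam ≤ ℓ := min_le_right _ _
  have hlam0' : lam ≤ lam0 := min_le_left _ _
  set g : ℝ → ℝ := fun u => min (I * (u - a) ^ (-(1 / 2 : ℝ))) (4 * π / (φ * (u - a))) with hg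
  -- continuity of the two branches off `u = a`
  have hc1 : ContinuousOn (fun u : ℝ => I * (u - a) ^ (-(1 / 2 : ℝ))) (Ioi a) := by
    refine continuousOn_const.mul ?_
    exact ContinuousOn.rpow_const (continuousOn_id.sub continuousOn_const)
      (fun u hu => Or.inl (sub_ne_zero.2 (ne_of_gt hu)))
  have hc2 : ContinuousOn (fun u : ℝ => 4 * π / (φ * (u - a))) (Ioi a) := by
    refine continuousOn_const.div (continuousOn_const.mul (continuousOn_id.sub continuousOn_const)) ?_
    intro u hu; exact mul_ne_zero hφ.ne' (sub_ne_zero.2 (ne_of_gt hu))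
  have hgc : ContinuousOn g (Ioi a) := by
    rw [hg]; exact continuous_min.comp_continuousOn (hc1.prodMk hc2)
  have hgnn : ∀ u, a < u → 0 ≤ g u := fun u hu => by
    rw [hg]
    exact le_min (mul_nonneg hI.le (Real.rpow_nonneg (by linarith) _))
      (div_nonneg (by positivity) (mul_nonneg hφ.le (by linarith)))
  -- piece 1: `[a, a+lam]`, dominated by the square-root branch
  have hsq_int : IntervalIntegrable (fun u : ℝ => I * (u - a) ^ (-(1 / 2 : ℝ))) volume a (a + lam) := by
    have h0 : IntervalIntegrable (fun x : ℝ => x ^ (-(1 / 2 : ℝ))) volume 0 lam :=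
      intervalIntegral.intervalIntegrable_rpow' (by norm_num)
    have h1 := (h0.comp_sub_right a).const_mul I
    simp only [zero_add] at h1
    rwa [add_comm lam a] at h1
  have hg_int1 : IntervalIntegrable g volume a (a + lam) := by
    refine hsq_int.mono_fun' ?_ ?_
    · refine (hgc.mono ?_).aestronglyMeasurable measurableSet_uIoc
      rw [uIoc_of_le (by linarith)]; exact fun u hu => hu.1
    · rw [uIoc_of_le (by linarith)]
      refine (ae_restrict_mem measurableSet_Ioc).mono fun u hu => ?_
      show ‖g u‖ ≤ I * (u - a) ^ (-(1 / 2 : ℝ))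
      rw [Real.norm_of_nonneg (hgnn u hu.1), hg]
      exact min_le_left _ _
  have hpiece1 : ∫ u in a..(a + lam), g u ≤ 8 * π / φ := by
    have hmono : ∫ u in a..(a + lam), g u ≤ ∫ u in a..(a + lam), I * (u - a) ^ (-(1 / 2 : ℝ)) := by
      refine intervalIntegral.integral_mono_on_of_le_Ioo (by linarith) hg_int1 hsq_int fun u hu => ?_
      rw [hg]; exact min_le_left _ _
    refine hmono.trans ?_
    rw [intervalIntegral.integral_const_mul, intervalIntegral_sub_rpow_neg_half a lam]
    -- `I · 2 lam^{1/2} ≤ I · 2 lam0^{1/2} = 8π/φ`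
    have hroot : lam ^ (1 / 2 : ℝ) ≤ lam0 ^ (1 / 2 : ℝ) := Real.rpow_le_rpow hlampos.le hlam0' (by norm_num)
    have hroot0 : lam0 ^ (1 / 2 : ℝ) = 4 * π / (I * φ) := by
      rw [hlam0, ← Real.sqrt_eq_rpow, Real.sqrt_sq (by positivity)]
    calc I * (2 * lam ^ (1 / 2 : ℝ)) ≤ I * (2 * lam0 ^ (1 / 2 : ℝ)) := by gcongr
      _ = 8 * π / φ := by rw [hroot0]; field_simp; ring
  -- piece 2: `[a+lam, a+ℓ]`, dominated by the `1/σ` branch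
  have hc2' : ContinuousOn (fun u : ℝ => 4 * π / (φ * (u - a))) (uIcc (a + lam) (a + ℓ)) := by
    refine hc2.mono ?_
    rw [uIcc_of_le (by linarith)]; exact fun u hu => by simp only [mem_Ioi]; linarith [hu.1]
  have hgc' : ContinuousOn g (uIcc (a + lam) (a + ℓ)) := by
    refine hgc.mono ?_
    rw [uIcc_of_le (by linarith)]; exact fun u hu => by simp only [mem_Ioi]; linarith [hu.1]
  have hpiece2 : ∫ u in (a + lam)..(a + ℓ), g u ≤ (4 * π / φ) * Real.log (ℓ / lam) := by
    have hmono : ∫ u in (a + lam)..(a + ℓ), g u ≤ ∫ u in (a + lam)..(a + ℓ), 4 * π / (φ * (u - a)) := by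
      refine intervalIntegral.integral_mono_on (by linarith) hgc'.intervalIntegrable hc2'.intervalIntegrable
        fun u _ => ?_
      rw [hg]; exact min_le_right _ _
    refine hmono.trans (le_of_eq ?_)
    have hfun : (fun u : ℝ => 4 * π / (φ * (u - a))) = fun u => (4 * π / φ) * (u - a)⁻¹ := by
      funext u; rw [mul_comm φ, ← div_div, div_eq_mul_inv]
      ring
    rw [hfun, intervalIntegral.integral_const_mul, intervalIntegral_inv_sub hlampos hlamℓ]
  -- the logarithm: `log(ℓ/lam) ≤ log⁺(a/lam0) = log⁺(a I² φ²/(16π²))`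
  have hlog : Real.log (ℓ / lam) ≤ max 0 (Real.log (a * (I ^ 2 * φ ^ 2 / (16 * π ^ 2)))) := by
    rcases min_cases lam0 ℓ with ⟨hm, hle⟩ | ⟨hm, hlt⟩
    · -- lam = lam0 ≤ ℓ ≤ a
      have hlamv : lam = lam0 := by rw [hlam, hm]
      refine le_trans ?_ (le_max_right _ _)
      rw [hlamv]
      refine Real.log_le_log (div_pos hℓ hlam0pos) ?_
      have ha' : a * (I ^ 2 * φ ^ 2 / (16 * π ^ 2)) = a / lam0 := by
        rw [hlam0]; field_simp; ring
      rw [ha']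
      exact div_le_div_of_nonneg_right hℓa hlam0pos.le
    · -- lam = ℓ
      have hlamv : lam = ℓ := by rw [hlam, hm]
      rw [hlamv, div_self hℓ.ne', Real.log_one]
      exact le_max_left _ _
  -- combine
  have hsplit : ∫ u in a..(a + ℓ), g u = (∫ u in a..(a + lam), g u) + ∫ u in (a + lam)..(a + ℓ), g u :=
    (intervalIntegral.integral_add_adjacent_intervals hg_int1 hgc'.intervalIntegrable).symm
  rw [hsplit]
  have h4 : 0 ≤ 4 * π / φ := by positivity
  calc (∫ u in a..(a + lam), g u) + ∫ u in (a + lam)..(a + ℓ), g u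
      ≤ 8 * π / φ + (4 * π / φ) * Real.log (ℓ / lam) := add_le_add hpiece1 hpiece2
    _ ≤ 8 * π / φ + (4 * π / φ) * max 0 (Real.log (a * (I ^ 2 * φ ^ 2 / (16 * π ^ 2)))) := by
        gcongr
    _ = (4 * π / φ) * (2 + max 0 (Real.log (a * (I ^ 2 * φ ^ 2 / (16 * π ^ 2))))) := by ring


/-- Interval-integrability of the crossover minimum on any `[a, c]` (dominated by the square-root branch). -/
theorem intervalIntegrable_crossMin {I φ a c : ℝ} (hI : 0 < I) (hφ : 0 < φ) (hac : a ≤ c) :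
    IntervalIntegrable (fun u : ℝ => min (I * (u - a) ^ (-(1 / 2 : ℝ))) (4 * π / (φ * (u - a)))) volume a c := by
  have hc1 : ContinuousOn (fun u : ℝ => I * (u - a) ^ (-(1 / 2 : ℝ))) (Ioi a) := by
    refine continuousOn_const.mul ?_
    exact ContinuousOn.rpow_const (continuousOn_id.sub continuousOn_const)
      (fun u hu => Or.inl (sub_ne_zero.2 (ne_of_gt hu)))
  have hc2 : ContinuousOn (fun u : ℝ => 4 * π / (φ * (u - a))) (Ioi a) := by
    refine continuousOn_const.div (continuousOn_const.mul (continuousOn_id.sub continuousOn_const)) ?_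
    intro u hu; exact mul_ne_zero hφ.ne' (sub_ne_zero.2 (ne_of_gt hu))
  have hgc : ContinuousOn (fun u : ℝ => min (I * (u - a) ^ (-(1 / 2 : ℝ))) (4 * π / (φ * (u - a)))) (Ioi a) :=
    continuous_min.comp_continuousOn (hc1.prodMk hc2)
  have hsq_int : IntervalIntegrable (fun u : ℝ => I * (u - a) ^ (-(1 / 2 : ℝ))) volume a c := by
    have h0 : IntervalIntegrable (fun x : ℝ => x ^ (-(1 / 2 : ℝ))) volume 0 (c - a) :=
      intervalIntegral.intervalIntegrable_rpow' (by norm_num)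
    have h1 := (h0.comp_sub_right a).const_mul I
    simp only [zero_add, sub_add_cancel] at h1
    exact h1
  refine hsq_int.mono_fun' ?_ ?_
  · refine (hgc.mono ?_).aestronglyMeasurable measurableSet_uIoc
    rw [uIoc_of_le hac]; exact fun u hu => hu.1
  · rw [uIoc_of_le hac]
    refine (ae_restrict_mem measurableSet_Ioc).mono fun u hu => ?_
    show ‖min (I * (u - a) ^ (-(1 / 2 : ℝ))) (4 * π / (φ * (u - a)))‖ ≤ I * (u - a) ^ (-(1 / 2 : ℝ))
    have h1 : 0 ≤ I * (u - a) ^ (-(1 / 2 : ℝ)) := mul_nonneg hI.le (Real.rpow_nonneg (by linarith [hu.1]) _)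
    have h2 : 0 ≤ 4 * π / (φ * (u - a)) := div_nonneg (by positivity) (mul_nonneg hφ.le (by linarith [hu.1]))
    rw [Real.norm_of_nonneg (le_min h1 h2)]
    exact min_le_left _ _


end RecessionLaw

end Summit.NavierStokesRegularity.NavierStokesRegularity.Cruxes.TypeIQuantSubcubicExp.QuietCore

end
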